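import Summits.ABC.StewartYu.KappaDoorSlot
import HarnessLib

/-!
# Cell abc-stewartyu, the κ-DOOR at ALL places, I: one `p`-adic slot for an ARBITRARY member

`Summits/ABC/StewartYu/KappaDoorSlotAll.lean` — cell `abc-stewartyu` (seat p1; theorems only, no
definition, no named fact). The tree's one-slot lemma `KappaDoor.log_le_of_kappaSlot`
(`KappaDoorSlot.lean`, p3) takes the `Fin`-shaped one-prime input `FinBoundAt p K L κ σ τ τ₁` at the
ODD primes only and therefore needs the member `w` of the triple to be ODD. When the input is
available at EVERY prime — the situation of the planner's three-slot door `KappaDoorSpec`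
(HOME/plan/Skeleton.lean: all places ⇒ `EpsShapeBound (2·max(1,κ)/3)`, Stewart–Yu 1991 §3 with
THREE `p`-adic routes), e.g. once the `2`-adic engine of crux `YuNinetyTwo` lands next to an
odd-prime bound — the same max-ord device (9) bounds `log w` for ANY member `w` coprime to `uv`,
even or odd. This file is that one-hypothesis generalisation (proof verbatim minus the parity
step); it is the first brick of the three-slot door (which, with κ = 5/2 at the odd primes from
WP-M♭ and κ = 1 at `p = 2`, would give `rad^{5/3+ε}`).

* `log_le_of_kappaSlot_all` — for `w` coprime to `uv` with the congruences
  `ord_p w ≤ ord_p(∏_{q ∣ uv} q^{e_q} − 1)` at every `p ∣ w`: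
  `log w ≤ K·Lⁿ·n^{κn}·P(w)^σ·(∏_{q ∣ uv} log q)·(log B)^τ·(log G)^{τ₁+1}`, `n = ω(uv)`.

Everything is [folklore] book-keeping on the printed line [StewartYu1991, (9)–(14)].
-/

noncomputable section

open Finset Real
open Literature.NumberTheory.DiophantineGeometry
open Literature.Barriers.ABC

namespace Summit.ABC.StewartYu

namespace KappaDoor

/-- **One `p`-adic slot with an `n^{κn}·p^σ` input at ALL primes, for an ARBITRARY member.** Let `w`
be coprime to `uv` (any parity), with `ord_p w ≤ ord_p(∏_{q ∣ uv} q^{e_q} − 1)` for every `p ∣ w`,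
`|e_q| ≤ B` (`B ≥ 3`), `∏ q^{e_q} ≠ 1`; let `G ≥ 4` bound `∏_{q ∣ uv} q` and `rad w`, and `σ ≥ 0`;
assume the one-prime bound `FinBoundAt p K L κ σ τ τ₁` at EVERY prime `p`. Then
`log w ≤ K·Lⁿ·n^{κn}·P(w)^σ·(∏_{q ∣ uv} log q)·((log B)^τ·(log G)^{τ₁}·log G)`, `n = ω(uv)`.
[folklore] -/
theorem log_le_of_kappaSlot_all {K L κ σ : ℝ} {τ τ₁ : ℕ} (hK : 0 ≤ K) (hL : 0 ≤ L) (hσ : 0 ≤ σ)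
    (hP : ∀ p : ℕ, p.Prime → FinBoundAt p K L κ σ τ τ₁)
    {G : ℝ} (hG4 : 4 ≤ G) {B : ℝ} (hB3 : 3 ≤ B)
    {w u v : ℕ} (e : ℕ → ℤ) (hw : w ≠ 0) (hwuv : w.Coprime (u * v))
    (hqG : ∏ q ∈ (u * v).primeFactors, (q : ℝ) ≤ G)
    (hwG : ∏ p ∈ w.primeFactors, (p : ℝ) ≤ G)
    (heB : ∀ q ∈ (u * v).primeFactors, (|e q| : ℝ) ≤ B)
    (hne1 : ∏ q ∈ (u * v).primeFactors, (q : ℚ) ^ e q ≠ 1)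
    (hval : ∀ p ∈ w.primeFactors, (w.factorization p : ℝ) ≤
      padicValRat p (∏ q ∈ (u * v).primeFactors, (q : ℚ) ^ e q - 1)) :
    Real.log w ≤ K * L ^ (u * v).primeFactors.card *
      ((u * v).primeFactors.card : ℝ) ^ (κ * (u * v).primeFactors.card) *
      (largestPrimeFactor w : ℝ) ^ σ * (∏ q ∈ (u * v).primeFactors, Real.log q) *
      (Real.log B ^ τ * Real.log G ^ τ₁ * Real.log G) := by
  classical
  set T := (u * v).primeFactors with hT
  set n := T.card with hn
  set PL := ∏ q ∈ T, Real.log (q : ℝ) with hPL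
  set Pw : ℝ := (largestPrimeFactor w : ℝ) with hPw
  set LG := Real.log G with hLG
  have hG1 : (1 : ℝ) ≤ G := by linarith
  have hLG0 : 0 ≤ LG := Real.log_nonneg hG1
  have hlogB0 : 0 ≤ Real.log B := Real.log_nonneg (by linarith)
  have hTprime : ∀ q ∈ T, q.Prime := fun q hq => Nat.prime_of_mem_primeFactors hq
  have hPL0 : 0 ≤ PL := Finset.prod_nonneg fun q hq =>
    Real.log_nonneg (by exact_mod_cast (hTprime q hq).one_lt.le)
  have hnκ : 0 ≤ (n : ℝ) ^ (κ * n) := Real.rpow_nonneg (Nat.cast_nonneg _) _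
  have hPw1 : (1 : ℝ) ≤ Pw := by rw [hPw]; exact_mod_cast one_le_largestPrimeFactor w
  set M : ℝ := K * L ^ n * (n : ℝ) ^ (κ * n) * Pw ^ σ * PL * (Real.log B ^ τ * LG ^ τ₁) with hM
  have hM0 : 0 ≤ M := by
    have : 0 ≤ Pw ^ σ := Real.rpow_nonneg (by linarith) _
    rw [hM]; positivity
  -- the factor `log max(3, ∏_{uv} q) ≤ log G`
  have hmax : Real.log (max 3 (∏ q ∈ T, (q : ℝ))) ≤ LG := by
    refine Real.log_le_log (lt_of_lt_of_le (by norm_num) (le_max_left _ _)) (max_le (by linarith) hqG)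
  have hmax0 : 0 ≤ Real.log (max 3 (∏ q ∈ T, (q : ℝ))) :=
    Real.log_nonneg ((le_max_left _ _).trans' (by norm_num))
  -- every exponent of `w` is at most `M`
  have hbound : ∀ p ∈ w.primeFactors, (w.factorization p : ℝ) ≤ M := by
    intro p hp
    have hpp : p.Prime := Nat.prime_of_mem_primeFactors hp
    have hpT : p ∉ T := by
      intro hpT
      have h1 : p ∣ w := Nat.dvd_of_mem_primeFactors hp
      have h2 : p ∣ u * v := Nat.dvd_of_mem_primeFactors hpT
      have hg : p ∣ Nat.gcd w (u * v) := Nat.dvd_gcd h1 h2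
      rw [hwuv.gcd_eq_one, Nat.dvd_one] at hg
      exact hpp.one_lt.ne' hg
    have key := finsetBound_of_finBound (hP p hpp) hK hL hTprime hpT e hB3 heB hne1
    have hpP : (p : ℝ) ^ σ ≤ Pw ^ σ := by
      have : (p : ℝ) ≤ Pw := by rw [hPw]; exact_mod_cast le_largestPrimeFactor_of_mem_primeFactors hp
      exact Real.rpow_le_rpow (Nat.cast_nonneg _) this hσ
    have hp0 : (0 : ℝ) ≤ (p : ℝ) ^ σ := Real.rpow_nonneg (Nat.cast_nonneg _) _
    calc (w.factorization p : ℝ)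
        ≤ padicValRat p (∏ q ∈ T, (q : ℚ) ^ e q - 1) := hval p hp
      _ ≤ K * L ^ n * (n : ℝ) ^ (κ * n) * (p : ℝ) ^ σ * PL * Real.log B ^ τ *
            Real.log (max 3 (∏ q ∈ T, (q : ℝ))) ^ τ₁ := key
      _ ≤ K * L ^ n * (n : ℝ) ^ (κ * n) * Pw ^ σ * PL * Real.log B ^ τ * LG ^ τ₁ := by
          have h1 : K * L ^ n * (n : ℝ) ^ (κ * n) * (p : ℝ) ^ σ * PL * Real.log B ^ τ ≤
              K * L ^ n * (n : ℝ) ^ (κ * n) * Pw ^ σ * PL * Real.log B ^ τ := by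
            have h0 : 0 ≤ K * L ^ n * (n : ℝ) ^ (κ * n) := by positivity
            have := mul_le_mul_of_nonneg_left hpP h0
            exact mul_le_mul_of_nonneg_right (mul_le_mul_of_nonneg_right this hPL0) (by positivity)
          have h2 : Real.log (max 3 (∏ q ∈ T, (q : ℝ))) ^ τ₁ ≤ LG ^ τ₁ := pow_le_pow_left₀ hmax0 hmax τ₁
          have h3 : 0 ≤ K * L ^ n * (n : ℝ) ^ (κ * n) * Pw ^ σ * PL * Real.log B ^ τ := by
            have : 0 ≤ Pw ^ σ := Real.rpow_nonneg (by linarith) _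
            positivity
          exact mul_le_mul h1 h2 (pow_nonneg hmax0 _) h3
      _ = M := by rw [hM]; ring
  -- (9)
  have h9 := log_le_mul_log_prod_primeFactors hw hbound
  have hradw : Real.log (∏ p ∈ w.primeFactors, (p : ℝ)) ≤ LG := by
    rw [hLG]
    apply Real.log_le_log _ hwG
    exact Finset.prod_pos fun q hq => by exact_mod_cast (Nat.prime_of_mem_primeFactors hq).pos
  calc Real.log w ≤ M * Real.log (∏ p ∈ w.primeFactors, (p : ℝ)) := h9
    _ ≤ M * LG := mul_le_mul_of_nonneg_left hradw hM0
    _ = K * L ^ n * (n : ℝ) ^ (κ * n) * Pw ^ σ * PL * (Real.log B ^ τ * LG ^ τ₁ * LG) := by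
        rw [hM]; ring

end KappaDoor

end Summit.ABC.StewartYu

end
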